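import Literature.AlgebraicGeometry.Resolution.DifferentialOperators
import Mathlib.RingTheory.Kaehler.Basic
import HarnessLib

/-!
# Mizutani's conjecture `m(e) = 2p^e − 1` — differential operators as functionals on `A ⊗ B` (EGA IV 16.8.8)

Cell topic `Summits/ResolutionOfSingularities/KangarooAtlas` (pub-rosobs); namespace
`Summit.ResolutionOfSingularities.KangarooAtlas.Mizutani`.  Part of the Lean transcription of the
in-house note MIZUTANI-PROOF-g59 (AI-written, AI-audited; *AI review is weaker than expert review*; not a
resolution theorem).  This file starts the §3 DICTIONARY (from Oda's description of the invariant additive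
forms, `Literature/…/HironakaGroupScheme.lean`, to towers and tensor rank): Grothendieck's characterisation
of differential operators through the diagonal ideal.

For an `R`-algebra map `f : A → B` of commutative rings and an `R`-linear `D : A → A` put
`dPair f D : A ⊗_R B → B`, `α ⊗ y ↦ f(D α)·y`, and let `diagIdeal f ⊂ A ⊗_R B` be the ideal generated by the
`1 ⊗ f(α) − α ⊗ 1` (for `f = id` this is Mathlib's `KaehlerDifferential.ideal R A`, the kernel of the
multiplication map).  Then (`dPair_gen_mul`) `dPair f D ((1 ⊗ fα − α ⊗ 1)·w) = − dPair f [D, α] w`, whence: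

* `dPair_eq_zero_of_isDiffOpLE` — if `D` is a differential operator of order `≤ m` (the tree's `IsDiffOpLE`,
  EGA IV 16.8.8 (b)) then `dPair f D` kills `(diagIdeal f)^{m+1}`;
* `isDiffOpLE_of_dPair_eq_zero` / `isDiffOpLE_iff_dPair` — for `f = id` the converse: `D` has order `≤ m`
  iff `x ⊗ y ↦ D(x)·y` kills `J^{m+1}`, `J = ker(A ⊗_R A → A)` (EGA IV 16.8.8 (a) ⟺ (b): the definition of
  differential operators through principal parts `A ⊗ A / J^{m+1}`);
* `IsDiffOpLE.of_ringEquiv` — transport of the order along a ring isomorphism (used for the Frobenius twist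
  `k ≅ k^p` of MIZUTANI-PROOF-g59 §3 (d)).

References: [EGAIV4] Prop. 16.8.8; [Oda1983HironakaGroupSchemeII] §1 (p. 1165: "D in 𝒟 can be identified with
a (1 ⊗ F^{-∞}(k))-linear functional on F^{-∞}(k) ⊗_k F^{-∞}(k)").
-/

open TensorProduct Literature.AlgebraicGeometry.Resolution

namespace Summit.ResolutionOfSingularities.KangarooAtlas.Mizutani

section Pairing

variable (R : Type*) [CommRing R] {A B : Type*} [CommRing A] [CommRing B] [Algebra R A] [Algebra R B]

/-- **The pairing of a linear endomorphism with the tensor square**: `dPair f D : A ⊗_R B → B`,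
`α ⊗ y ↦ f(D α)·y` (Grothendieck: the functional on principal parts attached to `D`).
[cite: EGAIV4, Prop. 16.8.8 (with Déf. 16.8.1: D = u ∘ d^n, u linear on P^n = (A ⊗ A)/J^{n+1})] -/
noncomputable def dPair (f : A →ₐ[R] B) (D : A →ₗ[R] A) : A ⊗[R] B →ₗ[R] B :=
  TensorProduct.lift ((LinearMap.mul R B).comp (f.toLinearMap.comp D))

/-- `dPair f D (α ⊗ y) = f(D α)·y`. [cite: EGAIV4, Prop. 16.8.8] -/
@[simp] theorem dPair_tmul (f : A →ₐ[R] B) (D : A →ₗ[R] A) (α : A) (y : B) :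
    dPair R f D (α ⊗ₜ y) = f (D α) * y := by
  unfold dPair
  rw [TensorProduct.lift.tmul]
  rfl

/-- `dPair` is additive in `D`. [folklore] -/
theorem dPair_add (f : A →ₐ[R] B) (D E : A →ₗ[R] A) : dPair R f (D + E) = dPair R f D + dPair R f E := by
  refine TensorProduct.ext' fun α y => ?_
  simp only [dPair_tmul, LinearMap.add_apply, map_add, add_mul]

/-- `dPair f 0 = 0`. [folklore] -/
@[simp] theorem dPair_zero (f : A →ₐ[R] B) : dPair R f (0 : A →ₗ[R] A) = 0 := by
  refine TensorProduct.ext' fun α y => ?_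
  simp only [dPair_tmul, LinearMap.zero_apply, map_zero, zero_mul]

/-- `dPair f D` is `B`-linear for the right multiplication: `dPair (w · (1 ⊗ y)) = dPair(w) · y`. [folklore] -/
theorem dPair_mul_one_tmul (f : A →ₐ[R] B) (D : A →ₗ[R] A) (w : A ⊗[R] B) (y : B) :
    dPair R f D (w * (1 ⊗ₜ y)) = dPair R f D w * y := by
  induction w using TensorProduct.induction_on with
  | zero => rw [zero_mul, map_zero, zero_mul]
  | tmul α z =>
    rw [Algebra.TensorProduct.tmul_mul_tmul, mul_one, dPair_tmul, dPair_tmul, mul_assoc]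
  | add w₁ w₂ h₁ h₂ => rw [add_mul, map_add, map_add, h₁, h₂, add_mul]

/-- **The diagonal ideal of `f`**: the ideal of `A ⊗_R B` generated by the `1 ⊗ f(α) − α ⊗ 1` (for `f = id`
the kernel of multiplication, `diagIdeal_id`). [cite: EGAIV4, Prop. 16.8.8 (the ideal J of the diagonal)] -/
def diagIdeal (f : A →ₐ[R] B) : Ideal (A ⊗[R] B) :=
  Ideal.span (Set.range fun α : A => (1 : A) ⊗ₜ[R] f α - α ⊗ₜ[R] (1 : B))

/-- The generators lie in the diagonal ideal. [folklore] -/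
theorem gen_mem_diagIdeal (f : A →ₐ[R] B) (α : A) :
    (1 : A) ⊗ₜ[R] f α - α ⊗ₜ[R] (1 : B) ∈ diagIdeal R f :=
  Ideal.subset_span ⟨α, rfl⟩

/-- For `f = id` the diagonal ideal is the kernel of the multiplication map `A ⊗_R A → A`
(Mathlib's `KaehlerDifferential.ideal`). [cite: EGAIV4, Prop. 16.8.8] -/
theorem diagIdeal_id : diagIdeal R (AlgHom.id R A) = KaehlerDifferential.ideal R A :=
  KaehlerDifferential.span_range_eq_ideal R A

/-- **The key computation**: `dPair f D ((1 ⊗ fα − α ⊗ 1)·w) = − dPair f [D, α] w`.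
[cite: EGAIV4, Prop. 16.8.8 (proof: D_a and the ideal of the diagonal)] -/
theorem dPair_gen_mul (f : A →ₐ[R] B) (D : A →ₗ[R] A) (α : A) (w : A ⊗[R] B) :
    dPair R f D (((1 : A) ⊗ₜ[R] f α - α ⊗ₜ[R] (1 : B)) * w) = - dPair R f (commMul R D α) w := by
  induction w using TensorProduct.induction_on with
  | zero => rw [mul_zero, map_zero, map_zero, neg_zero]
  | tmul x y =>
    rw [sub_mul, Algebra.TensorProduct.tmul_mul_tmul, Algebra.TensorProduct.tmul_mul_tmul, one_mul, one_mul,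
      map_sub, dPair_tmul, dPair_tmul, dPair_tmul, commMul_apply, map_sub, map_mul f]
    ring
  | add w₁ w₂ h₁ h₂ => rw [mul_add, map_add, map_add, h₁, h₂, neg_add]

/-- If `dPair f E` kills an ideal `I`, then `dPair f D` kills `(1 ⊗ fα − α ⊗ 1)·I` whenever `[D, α] = E`;
packaged: `dPair f D` kills `diagIdeal f * I` as soon as every `dPair f [D, α]` kills `I`. [cite: EGAIV4, Prop. 16.8.8] -/
theorem dPair_eq_zero_of_mem_diagIdeal_mul (f : A →ₐ[R] B) (D : A →ₗ[R] A) (I : Ideal (A ⊗[R] B))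
    (hI : ∀ α : A, ∀ v ∈ I, dPair R f (commMul R D α) v = 0) :
    ∀ w ∈ diagIdeal R f * I, dPair R f D w = 0 := by
  intro w hw
  refine Submodule.mul_induction_on hw (fun j hj v hv => ?_) (fun x y hx hy => by rw [map_add, hx, hy, add_zero])
  -- `j ∈ diagIdeal f`: induction on the span
  revert v
  refine Submodule.span_induction (p := fun j _ => ∀ v ∈ I, dPair R f D (j * v) = 0) ?_ ?_ ?_ ?_ hj
  · rintro _ ⟨α, rfl⟩ v hv
    rw [dPair_gen_mul, hI α v hv, neg_zero]
  · intro v _; rw [zero_mul, map_zero]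
  · intro x y _ _ hx hy v hv
    rw [add_mul, map_add, hx v hv, hy v hv, add_zero]
  · intro r x _ hx v hv
    rw [smul_eq_mul, mul_assoc, mul_comm r, mul_assoc]
    exact hx (v * r) (I.mul_mem_right r hv)

/-- **Differential operators of order `≤ m` kill `J^{m+1}`** (EGA IV 16.8.8 (b) ⟹ (a), for any `R`-algebra map
`f : A → B`): if `IsDiffOpLE R m D` then `α ⊗ y ↦ f(D α)·y` vanishes on `(diagIdeal f)^{m+1}`.
[cite: EGAIV4, Prop. 16.8.8] -/
theorem dPair_eq_zero_of_isDiffOpLE (f : A →ₐ[R] B) :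
    ∀ (m : ℕ) {D : A →ₗ[R] A}, IsDiffOpLE R m D → ∀ w ∈ diagIdeal R f ^ (m + 1), dPair R f D w = 0
  | 0, D, hD, w, hw => by
    rw [zero_add, pow_one, ← Ideal.mul_top (diagIdeal R f)] at hw
    refine dPair_eq_zero_of_mem_diagIdeal_mul R f D ⊤ (fun α v _ => ?_) w hw
    rw [hD α, dPair_zero, LinearMap.zero_apply]
  | m + 1, D, hD, w, hw => by
    rw [pow_succ'] at hw
    exact dPair_eq_zero_of_mem_diagIdeal_mul R f D _
      (fun α v hv => dPair_eq_zero_of_isDiffOpLE f m (hD α) v hv) w hw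

/-- **Conversely** (`f = id`, EGA IV 16.8.8 (a) ⟹ (b)): if `x ⊗ y ↦ D(x)·y` kills `J^{m+1}`, `J` the kernel of
`A ⊗_R A → A`, then `D` is a differential operator of order `≤ m`. [cite: EGAIV4, Prop. 16.8.8] -/
theorem isDiffOpLE_of_dPair_eq_zero :
    ∀ (m : ℕ) {D : A →ₗ[R] A}, (∀ w ∈ diagIdeal R (AlgHom.id R A) ^ (m + 1), dPair R (AlgHom.id R A) D w = 0) →
      IsDiffOpLE R m D
  | 0, D, h => by
    intro α
    ext x
    have hmem : ((1 : A) ⊗ₜ[R] (AlgHom.id R A) α - α ⊗ₜ[R] (1 : A)) * (x ⊗ₜ[R] (1 : A)) ∈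
        diagIdeal R (AlgHom.id R A) ^ (0 + 1) := by
      rw [zero_add, pow_one]
      exact Ideal.mul_mem_right _ _ (gen_mem_diagIdeal R _ α)
    have := h _ hmem
    rw [dPair_gen_mul, dPair_tmul, AlgHom.id_apply, mul_one, neg_eq_zero] at this
    rw [this, LinearMap.zero_apply]
  | m + 1, D, h => by
    intro α
    refine isDiffOpLE_of_dPair_eq_zero m fun w hw => ?_
    have hmem : ((1 : A) ⊗ₜ[R] (AlgHom.id R A) α - α ⊗ₜ[R] (1 : A)) * w ∈
        diagIdeal R (AlgHom.id R A) ^ (m + 1 + 1) := by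
      rw [pow_succ' _ (m + 1)]
      exact Ideal.mul_mem_mul (gen_mem_diagIdeal R _ α) hw
    have := h _ hmem
    rwa [dPair_gen_mul, neg_eq_zero] at this

/-- **EGA IV 16.8.8 (a) ⟺ (b)**: `D` is a differential operator of order `≤ m` iff the functional
`x ⊗ y ↦ D(x)·y` on `A ⊗_R A` kills the `(m+1)`-st power of the kernel of multiplication.
[cite: EGAIV4, Prop. 16.8.8] -/
theorem isDiffOpLE_iff_dPair (m : ℕ) (D : A →ₗ[R] A) :
    IsDiffOpLE R m D ↔ ∀ w ∈ KaehlerDifferential.ideal R A ^ (m + 1), dPair R (AlgHom.id R A) D w = 0 := by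
  rw [← diagIdeal_id]
  exact ⟨fun h => dPair_eq_zero_of_isDiffOpLE R (AlgHom.id R A) m h, isDiffOpLE_of_dPair_eq_zero R m⟩

end Pairing

/-! ## Transport of the order along a ring isomorphism -/

section Transport

variable {R R' A A' : Type*} [CommSemiring R] [CommSemiring R'] [CommRing A] [CommRing A']
  [Algebra R A] [Algebra R' A']

/-- Conjugating a commutator: if `D' ∘ σ = σ ∘ D` then `[D', σ a] ∘ σ = σ ∘ [D, a]`. [folklore] -/
theorem commMul_ringEquiv_apply (σ : A ≃+* A') (D : A →ₗ[R] A) (D' : A' →ₗ[R'] A')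
    (h : ∀ x, D' (σ x) = σ (D x)) (a x : A) :
    commMul R' D' (σ a) (σ x) = σ (commMul R D a x) := by
  rw [commMul_apply, commMul_apply, ← map_mul σ, h, h, map_sub, map_mul σ]

/-- **Transport of the order of a differential operator along a ring isomorphism** `σ : A ≃ A'`
(any coefficient rings `R`, `R'`: the order only depends on the underlying additive maps): if
`D' ∘ σ = σ ∘ D` then `D` of order `≤ n` implies `D'` of order `≤ n`. [cite: EGAIV4, Prop. 16.8.8 (the recursive criterion is intrinsic to the ring)] -/
theorem IsDiffOpLE.of_ringEquiv (σ : A ≃+* A') :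
    ∀ (n : ℕ) (D : A →ₗ[R] A) (D' : A' →ₗ[R'] A'), (∀ x, D' (σ x) = σ (D x)) →
      IsDiffOpLE R n D → IsDiffOpLE R' n D'
  | 0, D, D', h, hD => by
    intro a'
    obtain ⟨a, rfl⟩ := σ.surjective a'
    ext x'
    obtain ⟨x, rfl⟩ := σ.surjective x'
    rw [commMul_ringEquiv_apply σ D D' h, hD a, LinearMap.zero_apply, map_zero, LinearMap.zero_apply]
  | n + 1, D, D', h, hD => by
    intro a'
    obtain ⟨a, rfl⟩ := σ.surjective a'
    exact IsDiffOpLE.of_ringEquiv σ n (commMul R D a) (commMul R' D' (σ a))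
      (commMul_ringEquiv_apply σ D D' h a) (hD a)

/-- The same as an `iff` for a pair of intertwined operators. [cite: EGAIV4, Prop. 16.8.8] -/
theorem isDiffOpLE_iff_of_ringEquiv (σ : A ≃+* A') (n : ℕ) (D : A →ₗ[R] A) (D' : A' →ₗ[R'] A')
    (h : ∀ x, D' (σ x) = σ (D x)) : IsDiffOpLE R n D ↔ IsDiffOpLE R' n D' := by
  refine ⟨IsDiffOpLE.of_ringEquiv σ n D D' h, IsDiffOpLE.of_ringEquiv σ.symm n D' D fun x' => ?_⟩
  obtain ⟨x, rfl⟩ := σ.surjective x'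
  rw [RingEquiv.symm_apply_apply, h, RingEquiv.symm_apply_apply]

end Transport

end Summit.ResolutionOfSingularities.KangarooAtlas.Mizutani
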